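import Literature.AlgebraicGeometry.ComplexMultiplication.CyclotomicFermatCMTypesKoblitzEllipticFields
import HarnessLib

/-!
# The CM fields of Koblitz's elliptic Fermat factors at the IMPRIMITIVE levels `16, 18, 30, 40, 48, 60`: `ℚ(√−2)`, `ℚ(√−3)`, `ℚ(√−3)`,
# `ℚ(√−5)`, `ℚ(√−6)`, `ℚ(√−3)` — completing the table of CM fields over the whole printed list «{3,4,6,7,8,12,15,16,18,20,21,22,24,30,39,40,48,60}»

Layer `Literature/AlgebraicGeometry/ComplexMultiplication`; sequel of `CyclotomicFermatCMTypesKoblitzEllipticFields` (this lane gen 42: the primitive-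
character levels `15, 20, 22, 39` ↦ `ℚ(√−15), ℚ(√−5), ℚ(√−11), ℚ(√−39)`; honest column (b): «levels `16, 18, 30, 40, 48, 60` of the list have
imprimitive characters … and are not treated») and of `CyclotomicFermatCMTypesKoblitzEllipticLevels` (the witnesses `16:(1,6,9)` `H = {1,3,9,11}`,
`18:(1,3,14)` `{1,7,13}`, `30:(1,5,24)` `{1,7,13,19}`, `40:(1,18,21)` `{1,3,7,9,21,23,27,29}`, `48:(1,22,25)` `{1,5,7,11,25,29,31,35}`, `60:(1,10,49)`
`{1,7,13,19,31,37,43,49}`).  With the earlier files of the lane (`7, 21 ↦ ℚ(√−7)`; `8 ↦ ℚ(√−2), ℚ(i)`; `12 ↦ ℚ(i), ℚ(√−3)`; `24 ↦ ℚ(√−6), ℚ(i),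
ℚ(√−3), ℚ(√−2)`; `3, 4, 6`: `ℚ(ζ₃), ℚ(i)` themselves) every level of the printed list now has the CM field of (at least one of) its elliptic
K–R factors identified in the tree.  THEOREMS ONLY (no definition, no named fact, no `sorry`; kernel `decide` for the residue tables; the field
elements are fixed TERM BY TERM under every `σ_h`, `h ∈ H`, by exponent arithmetic `ζ^{he} = ζ^{he mod N}`).

THE SOURCES.  N. Koblitz, D. Rohrlich, Canad. J. Math. **30** (1978), §1 p. 1184 («complex multiplication by an order of the fixed field of `W_{r,s}`»);
M. Bauer, A. Coste, C. Itzykson, P. Ruelle, J. Geom. Phys. **22** (1997), §3.3 p. 14 («`K` the subfield of `ℚ(ζ_{n₀})` fixed by `W_{r,s,t}`»), §3.4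
p. 14 (Koblitz's list [kob]); L. C. Washington, *Introduction to Cyclotomic Fields*, Thm. 2.5.  The six identifications are OURS by the sources'
recipe (kernel); the fields come «from lower levels»: `H` is the preimage of a group at level `8, 3, 3, 20, 24, 3` respectively.

READING (as in the siblings).  `W = W(S_Φ)` the residue stabiliser; «`K`» = the field `K₁` of ANY primitive sub-pair `(K₁, Φ₁)` inducing `Φ`;
each statement «`W = H` ⟹ `K₁ = ℚ(δ)`» is about EVERY CM type of `ℚ(ζ_N)` with that stabiliser, in particular the K–R type of the witness triple.

## What is proved

* §0 (any `N`): `apply_zetaOf_pow_eq_pow_mod` (`σ(ζ^e) = ζ^{a(σ)·e mod N}`); private `eq_adjoin_of_mem_of_sq_eq_neg'`.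
* §1 `N = 16`, `H = {1,3,9,11}`: `zetaOf_pow_eight_sixteen` (`ζ⁸ = −1`), **`sq_delta_sixteen`** (`(ζ² + ζ⁶)² = −2`), `apply_core_sixteen`, `stabilizerResidues_sixteen`,
  **`eq_adjoin_delta_sixteen`** (`K₁ = ℚ(ζ² + ζ⁶) = ℚ(√−2)`), **`exists_isIsogeny_pow_elliptic_sixteen`** (`A ∼ E⁴`, `E` CM by `𝓞_{ℚ(√−2)}`), `…_fermat_sixteen` (`(1,6,9)`).
* §2 `N = 18`, `H = {1,7,13}`: `cyclotomic_relation_eighteen` (`ζ⁶ − ζ³ + 1 = 0`), **`sq_delta_eighteen`** (`(1 + 2ζ⁶)² = −3`), …, **`eq_adjoin_delta_eighteen`**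
  (`ℚ(√−3)`), **`exists_isIsogeny_pow_elliptic_eighteen`** (`A ∼ E³`), `…_fermat_eighteen` (`(1,3,14)`).
* §3 `N = 30`, `H = {1,7,13,19}`: `cyclotomic_relation_thirty` (`ζ²⁰ + ζ¹⁰ + 1 = 0`), **`sq_delta_thirty`** (`(1 + 2ζ¹⁰)² = −3`), …, `A ∼ E⁴`, `(1,5,24)`.
* §4 `N = 40`, `H = {1,3,7,9,21,23,27,29}`: `cyclotomic_relation_forty` (`Φ₂₀(ζ²) = 0`), **`sq_delta_forty`** (`(ζ²+ζ⁶+ζ¹⁴+ζ¹⁸)² = −5`), …, `ℚ(√−5)`,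
  `A ∼ E⁸`, `(1,18,21)`.
* §5 `N = 48`, `H = {1,5,7,11,25,29,31,35}`: `cyclotomic_relation_fortyEight` (`Φ₂₄(ζ²) = 0`), **`sq_delta_fortyEight`** (`(ζ²+ζ¹⁰+ζ¹⁴+ζ²²)² = −6`),
  …, `ℚ(√−6)`, `A ∼ E⁸`, `(1,22,25)`.
* §6 `N = 60`, `H = {1,7,13,19,31,37,43,49}`: `cyclotomic_relation_sixty` (`ζ⁴⁰ + ζ²⁰ + 1 = 0`), **`sq_delta_sixty`** (`(1 + 2ζ²⁰)² = −3`), …, `ℚ(√−3)`,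
  `A ∼ E⁸`, `(1,10,49)`.

## Honest column

(a) As in the prequel: «`ℚ(√−d)`» is the explicit subfield `ℚ(δ) ⊂ ℚ(ζ_N)`, `δ² = −d`, `[ℚ(δ) : ℚ] = 2`; `E` up to isogeny; no rings of integers.
(b) Only ONE group `H` per level is treated (the witness'); other elliptic K–R types at the same level may have other fields (e.g. at `24` four
fields occur).  (c) Koblitz 1978 [kob] not held (acq-13294); nothing depends on it.  The Hodge conjecture is not proved and nothing here bears on it.
-/

noncomputable section

open NumberField

namespace Literature.AlgebraicGeometry.ComplexMultiplication

open CategoryTheory CategoryTheory.Limits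
open Literature.AlgebraicGeometry.Motives (CMType AbelianVariety)
open Literature.AlgebraicGeometry.Motives.AbelianVariety
open Literature.NumberTheory.ComplexMultiplication
open Literature.AlgebraicGeometry.HodgeTheory
open Literature.AlgebraicGeometry.Pohlmann1968 Literature.AlgebraicGeometry.Pohlmann1968.Cyclotomic
open CyclotomicCMTypeResidueSets (IsCMResidueSet unitResidues residueSet residueSet_cmTypeOfResidues isCMResidueSet_residueSet
  autResidue autResidue_spec exists_autResidue_eq)

/-! ## §0 Helpers at any level -/

section General

variable {N : ℕ} [NeZero N] {L : Type} [Field L] [NumberField L]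

/-- A quadratic subfield containing a square root `δ` of a negative integer is `ℚ(δ)`. [folklore] -/
private theorem eq_adjoin_of_mem_of_sq_eq_neg' {K₁ : IntermediateField ℚ L} {δ : L} (hδ : δ ∈ K₁) {m : ℕ} (hm : 0 < m)
    (hsq : δ ^ 2 = -(m : L)) (hdeg : Module.finrank ℚ K₁ = 2) : K₁ = IntermediateField.adjoin ℚ {δ} := by
  have hle : IntermediateField.adjoin ℚ {δ} ≤ K₁ := IntermediateField.adjoin_simple_le_iff.2 hδ
  have hne : Module.finrank ℚ (IntermediateField.adjoin ℚ {δ}) ≠ 1 := by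
    intro h1
    rw [IntermediateField.finrank_eq_one_iff, IntermediateField.adjoin_simple_eq_bot_iff, IntermediateField.mem_bot] at h1
    obtain ⟨q, hq⟩ := h1
    have hq2 : (algebraMap ℚ L) (q ^ 2) = (algebraMap ℚ L) (-(m : ℚ)) := by
      rw [map_pow, hq, hsq, map_neg, map_natCast]
    have hq2' : q ^ 2 = -(m : ℚ) := (algebraMap ℚ L).injective hq2
    have hm' : (0 : ℚ) < m := by exact_mod_cast hm
    nlinarith [sq_nonneg q]
  haveI : FiniteDimensional ℚ K₁ := inferInstance
  have hdvd : Module.finrank ℚ (IntermediateField.adjoin ℚ {δ}) ∣ 2 := hdeg ▸ IntermediateField.finrank_dvd_of_le_right hle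
  have h2 : Module.finrank ℚ (IntermediateField.adjoin ℚ {δ}) = 2 := by
    rcases (Nat.dvd_prime Nat.prime_two).1 hdvd with h | h
    · exact absurd h hne
    · exact h
  exact (IntermediateField.eq_of_le_of_finrank_eq hle (h2.trans hdeg.symm)).symm

variable [IsCyclotomicExtension {N} ℚ L]

/-- Exponents of `ζ_N` may be reduced modulo `N`. [cite: Washington1997, Ch. 2 (roots of unity)] -/
theorem zetaOf_pow_eq_pow_mod (m : ℕ) : zetaOf N L ^ m = zetaOf N L ^ (m % N) := by
  conv_lhs => rw [← Nat.div_add_mod m N, pow_add, pow_mul, (IsCyclotomicExtension.zeta_spec N ℚ L).pow_eq_one, one_pow, one_mul]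

/-- **`σ(ζ^e) = ζ^{a(σ)·e mod N}`** for an automorphism `σ` of `ℚ(ζ_N)` with exponent `a(σ)` (`ζ^σ = ζ^{a(σ)}`). [cite: Washington1997, Thm. 2.5] -/
theorem apply_zetaOf_pow_eq_pow_mod {σ : L ≃ₐ[ℚ] L} {a : ℕ} (hσ : (autResidue N L σ).val = a) (e : ℕ) :
    σ (zetaOf N L ^ e) = zetaOf N L ^ (a * e % N) := by
  rw [map_pow, autResidue_spec N σ, hσ, ← pow_mul, zetaOf_pow_eq_pow_mod]

end General

/-! ## `N = 16`: `H = {1, 3, 9, 11}`, `K₁ = ℚ(ζ ^ 2 + ζ ^ 6) = ℚ(√−2)` -/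

section Sixteen

variable {L : Type} [Field L] [NumberField L] [IsCyclotomicExtension {16} ℚ L]

/-- `ζ^16 = 1`. [cite: Washington1997, Ch. 2 (roots of unity)] -/
theorem zetaOf_pow_sixteen : zetaOf 16 L ^ 16 = 1 := (IsCyclotomicExtension.zeta_spec 16 ℚ L).pow_eq_one

/-- `ζ^8 = −1` in `ℚ(ζ_16)`. [cite: Washington1997, Ch. 2 (roots of unity)] -/
theorem zetaOf_pow_half_sixteen : zetaOf 16 L ^ 8 = -1 :=
  ((IsCyclotomicExtension.zeta_spec 16 ℚ L).pow (by norm_num) (show 16 = 8 * 2 by norm_num)).eq_neg_one_of_two_right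

/-- **`(ζ² + ζ⁶)² = −2`** in `ℚ(ζ₁₆)` (`ζ² = ζ₈`: the level-`8` element `ζ₈ + ζ₈³`). [cite: Washington1997, Ch. 2] [cite: BauerCosteItzyksonRuelle1997, §3.4] -/
theorem sq_delta_sixteen : (zetaOf 16 L ^ 2 + zetaOf 16 L ^ 6) ^ 2 = -2 := by
  linear_combination (zetaOf 16 L ^ 4 + 2) * zetaOf_pow_half_sixteen (L := L)

/-- `σ_h` fixes `ζ ^ 2 + ζ ^ 6` for every `h ∈ {1, 3, 9, 11}`, `h ≠ 1` (the exponents are permuted modulo `16`). [cite: Washington1997, Thm. 2.5] -/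
theorem apply_core_sixteen {σ : L ≃ₐ[ℚ] L} (hσ : autResidue 16 L σ ∈ ({3, 9, 11} : Finset (ZMod 16))) :
    σ (zetaOf 16 L ^ 2 + zetaOf 16 L ^ 6) = zetaOf 16 L ^ 2 + zetaOf 16 L ^ 6 := by
  simp only [Finset.mem_insert, Finset.mem_singleton] at hσ
  rcases hσ with hh | hh | hh
  · have hv : (autResidue 16 L σ).val = 3 := by rw [hh]; rfl
    simp only [map_add, apply_zetaOf_pow_eq_pow_mod hv, Nat.reduceMul, Nat.reduceMod]
    ring
  · have hv : (autResidue 16 L σ).val = 9 := by rw [hh]; rfl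
    simp only [map_add, apply_zetaOf_pow_eq_pow_mod hv, Nat.reduceMul, Nat.reduceMod]
  · have hv : (autResidue 16 L σ).val = 11 := by rw [hh]; rfl
    simp only [map_add, apply_zetaOf_pow_eq_pow_mod hv, Nat.reduceMul, Nat.reduceMod]
    ring

/-- `W({1, 3, 9, 11}) = {1, 3, 9, 11}` modulo `16` (kernel). [cite: BauerCosteItzyksonRuelle1997, §3.4] -/
theorem stabilizerResidues_sixteen :
    ((unitResidues 16).filter fun t => ∀ c ∈ unitResidues 16,
        (c * t ∈ ({1, 3, 9, 11} : Finset (ZMod 16)) ↔ c ∈ ({1, 3, 9, 11} : Finset (ZMod 16)))) = {1, 3, 9, 11} := by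
  decide

/-- **`W = {1, 3, 9, 11}` ⟹ `K₁ = ℚ(√−2) = ℚ(ζ ^ 2 + ζ ^ 6)`** for every CM type of `ℚ(ζ_16)` with this stabiliser and ANY primitive sub-pair
(`ζ ^ 2 + ζ ^ 6` is fixed by every `σ_h`, `h ∈ W`, so lies in `K₁`; its square is `−2 < 0`; `[K₁ : ℚ] = 2`).
[cite: KoblitzRohrlich1978, §1 p. 1184] [cite: BauerCosteItzyksonRuelle1997, §3.3] [cite: Shimura1998, §8.2 Prop. 26] -/
theorem eq_adjoin_delta_sixteen (Φ : CMType L) {K₁ : IntermediateField ℚ L} (Φ₁ : CMType K₁)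
    (h₁ : inducedCMType (algebraMap K₁ L) Φ₁ = Φ)
    (hp₁ : ∀ s t : K₁ →+* ℂ,
      (∀ τ : ℂ ≃+* ℂ, (τ : ℂ →+* ℂ).comp s ∈ Φ₁.1 ↔ (τ : ℂ →+* ℂ).comp t ∈ Φ₁.1) → s = t)
    (hW : ((unitResidues 16).filter fun t =>
        ∀ c ∈ unitResidues 16, (c * t ∈ residueSet 16 Φ ↔ c ∈ residueSet 16 Φ)) = {1, 3, 9, 11}) :
    zetaOf 16 L ^ 2 + zetaOf 16 L ^ 6 ∈ K₁ ∧ K₁ = IntermediateField.adjoin ℚ {zetaOf 16 L ^ 2 + zetaOf 16 L ^ 6} ∧ (zetaOf 16 L ^ 2 + zetaOf 16 L ^ 6) ^ 2 = -2 ∧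
      Module.finrank ℚ K₁ = 2 := by
  have hcore : zetaOf 16 L ^ 2 + zetaOf 16 L ^ 6 ∈ K₁ := by
    refine (mem_iff_forall_autResidue_mem_of_primitive (N := 16) Φ Φ₁ h₁ hp₁ _).2 fun γ hγ => ?_
    rw [hW, Finset.mem_insert] at hγ
    rcases hγ with h1 | hrest
    · rw [(autResidue_eq_one_iff (N := 16) γ).1 h1, AlgEquiv.one_apply]
    · exact apply_core_sixteen hrest
  have hmem := hcore
  have hdeg := finrank_eq_two_of_two_mul_card_eq (N := 16) Φ Φ₁ h₁ hp₁ (by rw [hW]; decide)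
  exact ⟨hmem, eq_adjoin_of_mem_of_sq_eq_neg' hmem (m := 2) (by norm_num) (by rw [sq_delta_sixteen]; norm_num) hdeg, sq_delta_sixteen, hdeg⟩

variable {Φ : CMType L} {A : AbelianVariety ℂ} {ι : 𝓞 L →+* End A} {θ : L →+* Module.End ℂ (complexBetti A.X 1)}

/-- **`N = 16`, `W = {1, 3, 9, 11}`: `A ∼ E^4` WITH `E` AN ELLIPTIC CURVE WITH COMPLEX MULTIPLICATION BY `𝓞_{ℚ(√−2)}`** (`K₁ = ℚ(δ)`,
`δ = ζ ^ 2 + ζ ^ 6`, `δ² = −2`; `𝓞_{K₁}`-equivariant isogeny onto `E^4`). [cite: KoblitzRohrlich1978, §1 p. 1184]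
[cite: BauerCosteItzyksonRuelle1997, §3.3–3.4] [cite: Shimura1998, §8.2 Prop. 26, §6.2 Thm. 3] -/
theorem exists_isIsogeny_pow_elliptic_sixteen (hA : IsCMTypeRealisation Φ A ι θ)
    (hW : ((unitResidues 16).filter fun t =>
        ∀ c ∈ unitResidues 16, (c * t ∈ residueSet 16 Φ ↔ c ∈ residueSet 16 Φ)) = {1, 3, 9, 11}) :
    ∃ (K₁ : IntermediateField ℚ L) (Φ₁ : CMType K₁), IsCMField K₁ ∧ Module.finrank ℚ K₁ = 2 ∧
      zetaOf 16 L ^ 2 + zetaOf 16 L ^ 6 ∈ K₁ ∧ K₁ = IntermediateField.adjoin ℚ {zetaOf 16 L ^ 2 + zetaOf 16 L ^ 6} ∧ (zetaOf 16 L ^ 2 + zetaOf 16 L ^ 6) ^ 2 = -2 ∧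
      inducedCMType (algebraMap K₁ L) Φ₁ = Φ ∧
      ∃ (E : AbelianVariety ℂ) (ιE : 𝓞 K₁ →+* End E) (θE : K₁ →+* Module.End ℂ (complexBetti E.X 1)),
        IsCMTypeRealisation Φ₁ E ιE θE ∧ E.IsSimple ∧ E.dim = 1 ∧
        ∃ (h : ℕ) (P : AbelianVariety ℂ) (π : Fin h → (P ⟶ E)), Nonempty (IsLimit (Fan.mk P π)) ∧ h = 4 ∧
          ∃ g : A ⟶ P, IsIsogeny g ∧
            ∀ (j : Fin h) (b : 𝓞 K₁), ι (RingOfIntegers.mapRingHom (algebraMap K₁ L : K₁ →+* L) b) ≫ (g ≫ π j) = (g ≫ π j) ≫ ιE b := by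
  haveI : IsCMField L := IsCyclotomicExtension.Rat.isCMField L (S := {16}) ⟨16, rfl, by norm_num⟩
  have h2W : 2 * ((unitResidues 16).filter fun t =>
        ∀ c ∈ unitResidues 16, (c * t ∈ residueSet 16 Φ ↔ c ∈ residueSet 16 Φ)).card = Nat.totient 16 := by
    rw [hW]; decide
  obtain ⟨K₁, Φ₁, hCM, hK2, h₁, hp₁, -, E, ιE, θE, hE, hs, hdE, h, P, π, hP, -, hhW, -, g, hg, hequiv⟩ :=
    exists_isIsogeny_power_elliptic_of_two_mul_card_filter (N := 16) hA h2W
  obtain ⟨hmem, hK, hsq, -⟩ := eq_adjoin_delta_sixteen Φ Φ₁ h₁ hp₁ hW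
  have hh : h = 4 := by rw [hhW, hW]; decide
  exact ⟨K₁, Φ₁, hCM, hK2, hmem, hK, hsq, h₁, E, ιE, θE, hE, hs, hdE, h, P, π, hP, hh, g, hg, hequiv⟩

namespace CyclotomicFermatCMType

/-- `H_{1,6,9} = {1, 3, 9, 11}` modulo `16` (Koblitz's level `16`; kernel). [cite: BauerCosteItzyksonRuelle1997, §3.4] -/
theorem fermatCMType_sixteen_witness : fermatCMType 16 1 6 9 = {1, 3, 9, 11} := by decide

/-- **The K–R type `Φ_{H_{1,6,9}}` modulo `16`: every realisation is `∼ E^4`, `E` elliptic with CM by `𝓞_{ℚ(√−2)}`.**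
[cite: KoblitzRohrlich1978, §1 p. 1184] [cite: BauerCosteItzyksonRuelle1997, §3.4] -/
theorem exists_isIsogeny_pow_elliptic_fermat_sixteen
    {hS : ∀ c : ZMod 16, c.val.Coprime 16 → (c ∈ fermatCMType 16 1 6 9 ↔ -c ∉ fermatCMType 16 1 6 9)}
    {A : AbelianVariety ℂ} {ι : 𝓞 L →+* End A} {θ : L →+* Module.End ℂ (complexBetti A.X 1)}
    (hA : IsCMTypeRealisation (cmTypeOfResidues (L := L) (fermatCMType 16 1 6 9) hS) A ι θ) :
    ∃ (K₁ : IntermediateField ℚ L) (Φ₁ : CMType K₁), IsCMField K₁ ∧ Module.finrank ℚ K₁ = 2 ∧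
      zetaOf 16 L ^ 2 + zetaOf 16 L ^ 6 ∈ K₁ ∧ K₁ = IntermediateField.adjoin ℚ {zetaOf 16 L ^ 2 + zetaOf 16 L ^ 6} ∧ (zetaOf 16 L ^ 2 + zetaOf 16 L ^ 6) ^ 2 = -2 ∧
      inducedCMType (algebraMap K₁ L) Φ₁ = cmTypeOfResidues (L := L) (fermatCMType 16 1 6 9) hS ∧
      ∃ (E : AbelianVariety ℂ) (ιE : 𝓞 K₁ →+* End E) (θE : K₁ →+* Module.End ℂ (complexBetti E.X 1)),
        IsCMTypeRealisation Φ₁ E ιE θE ∧ E.IsSimple ∧ E.dim = 1 ∧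
        ∃ (h : ℕ) (P : AbelianVariety ℂ) (π : Fin h → (P ⟶ E)), Nonempty (IsLimit (Fan.mk P π)) ∧ h = 4 ∧
          ∃ g : A ⟶ P, IsIsogeny g ∧
            ∀ (j : Fin h) (b : 𝓞 K₁), ι (RingOfIntegers.mapRingHom (algebraMap K₁ L : K₁ →+* L) b) ≫ (g ≫ π j) = (g ≫ π j) ≫ ιE b := by
  refine exists_isIsogeny_pow_elliptic_sixteen hA ?_
  rw [residueSet_cmTypeOfResidues 16 (isCMResidueSet_fermatCMType hS), fermatCMType_sixteen_witness]
  exact stabilizerResidues_sixteen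

end CyclotomicFermatCMType

end Sixteen

/-! ## `N = 18`: `H = {1, 7, 13}`, `K₁ = ℚ(1 + 2 * ζ ^ 6) = ℚ(√−3)` -/

section Eighteen

variable {L : Type} [Field L] [NumberField L] [IsCyclotomicExtension {18} ℚ L]

/-- `ζ^18 = 1`. [cite: Washington1997, Ch. 2 (roots of unity)] -/
theorem zetaOf_pow_eighteen : zetaOf 18 L ^ 18 = 1 := (IsCyclotomicExtension.zeta_spec 18 ℚ L).pow_eq_one

/-- `ζ^9 = −1` in `ℚ(ζ_18)`. [cite: Washington1997, Ch. 2 (roots of unity)] -/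
theorem zetaOf_pow_half_eighteen : zetaOf 18 L ^ 9 = -1 :=
  ((IsCyclotomicExtension.zeta_spec 18 ℚ L).pow (by norm_num) (show 18 = 9 * 2 by norm_num)).eq_neg_one_of_two_right

/-- **`Φ₁₈(ζ) = ζ⁶ − ζ³ + 1 = 0`** (`x = ζ³`: `x³ = −1`, `x ≠ −1`). [cite: Washington1997, Ch. 2 (cyclotomic polynomials)] -/
theorem cyclotomic_relation_eighteen : zetaOf 18 L ^ 6 - zetaOf 18 L ^ 3 + 1 = 0 := by
  have hprim : IsPrimitiveRoot (zetaOf 18 L) 18 := IsCyclotomicExtension.zeta_spec 18 ℚ L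
  have h6 : zetaOf 18 L ^ 6 ≠ 1 := hprim.pow_ne_one_of_pos_of_lt (by norm_num) (by norm_num)
  have hne : zetaOf 18 L ^ 3 + 1 ≠ 0 := by
    intro h
    apply h6
    have h3 : zetaOf 18 L ^ 3 = -1 := eq_neg_of_add_eq_zero_left h
    rw [show (6 : ℕ) = 3 * 2 from rfl, pow_mul, h3]
    norm_num
  have hmul : (zetaOf 18 L ^ 3 + 1) * (zetaOf 18 L ^ 6 - zetaOf 18 L ^ 3 + 1) = 0 := by
    linear_combination zetaOf_pow_half_eighteen (L := L)
  exact (mul_eq_zero.1 hmul).resolve_left hne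

/-- **`(1 + 2ζ⁶)² = −3`** in `ℚ(ζ₁₈)` (`ζ⁶ = ω`). [cite: Washington1997, Ch. 2] [cite: BauerCosteItzyksonRuelle1997, §3.4] -/
theorem sq_delta_eighteen : (1 + 2 * zetaOf 18 L ^ 6) ^ 2 = -3 := by
  linear_combination 4 * cyclotomic_relation_eighteen (L := L) + (4 * zetaOf 18 L ^ 3) * zetaOf_pow_half_eighteen (L := L)

/-- `σ_h` fixes `ζ ^ 6` for every `h ∈ {1, 7, 13}`, `h ≠ 1` (the exponents are permuted modulo `18`). [cite: Washington1997, Thm. 2.5] -/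
theorem apply_core_eighteen {σ : L ≃ₐ[ℚ] L} (hσ : autResidue 18 L σ ∈ ({7, 13} : Finset (ZMod 18))) :
    σ (zetaOf 18 L ^ 6) = zetaOf 18 L ^ 6 := by
  simp only [Finset.mem_insert, Finset.mem_singleton] at hσ
  rcases hσ with hh | hh
  · have hv : (autResidue 18 L σ).val = 7 := by rw [hh]; rfl
    simp only [apply_zetaOf_pow_eq_pow_mod hv, Nat.reduceMul, Nat.reduceMod]
  · have hv : (autResidue 18 L σ).val = 13 := by rw [hh]; rfl
    simp only [apply_zetaOf_pow_eq_pow_mod hv, Nat.reduceMul, Nat.reduceMod]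

/-- `W({1, 7, 13}) = {1, 7, 13}` modulo `18` (kernel). [cite: BauerCosteItzyksonRuelle1997, §3.4] -/
theorem stabilizerResidues_eighteen :
    ((unitResidues 18).filter fun t => ∀ c ∈ unitResidues 18,
        (c * t ∈ ({1, 7, 13} : Finset (ZMod 18)) ↔ c ∈ ({1, 7, 13} : Finset (ZMod 18)))) = {1, 7, 13} := by
  decide

/-- **`W = {1, 7, 13}` ⟹ `K₁ = ℚ(√−3) = ℚ(1 + 2 * ζ ^ 6)`** for every CM type of `ℚ(ζ_18)` with this stabiliser and ANY primitive sub-pair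
(`1 + 2 * ζ ^ 6` is fixed by every `σ_h`, `h ∈ W`, so lies in `K₁`; its square is `−3 < 0`; `[K₁ : ℚ] = 2`).
[cite: KoblitzRohrlich1978, §1 p. 1184] [cite: BauerCosteItzyksonRuelle1997, §3.3] [cite: Shimura1998, §8.2 Prop. 26] -/
theorem eq_adjoin_delta_eighteen (Φ : CMType L) {K₁ : IntermediateField ℚ L} (Φ₁ : CMType K₁)
    (h₁ : inducedCMType (algebraMap K₁ L) Φ₁ = Φ)
    (hp₁ : ∀ s t : K₁ →+* ℂ,
      (∀ τ : ℂ ≃+* ℂ, (τ : ℂ →+* ℂ).comp s ∈ Φ₁.1 ↔ (τ : ℂ →+* ℂ).comp t ∈ Φ₁.1) → s = t)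
    (hW : ((unitResidues 18).filter fun t =>
        ∀ c ∈ unitResidues 18, (c * t ∈ residueSet 18 Φ ↔ c ∈ residueSet 18 Φ)) = {1, 7, 13}) :
    1 + 2 * zetaOf 18 L ^ 6 ∈ K₁ ∧ K₁ = IntermediateField.adjoin ℚ {1 + 2 * zetaOf 18 L ^ 6} ∧ (1 + 2 * zetaOf 18 L ^ 6) ^ 2 = -3 ∧
      Module.finrank ℚ K₁ = 2 := by
  have hcore : zetaOf 18 L ^ 6 ∈ K₁ := by
    refine (mem_iff_forall_autResidue_mem_of_primitive (N := 18) Φ Φ₁ h₁ hp₁ _).2 fun γ hγ => ?_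
    rw [hW, Finset.mem_insert] at hγ
    rcases hγ with h1 | hrest
    · rw [(autResidue_eq_one_iff (N := 18) γ).1 h1, AlgEquiv.one_apply]
    · exact apply_core_eighteen hrest
  have h2 : (2 : L) ∈ K₁ := by exact_mod_cast IntermediateField.natCast_mem K₁ 2
  have hmem : 1 + 2 * zetaOf 18 L ^ 6 ∈ K₁ := add_mem (one_mem K₁) (mul_mem h2 hcore)
  have hdeg := finrank_eq_two_of_two_mul_card_eq (N := 18) Φ Φ₁ h₁ hp₁ (by rw [hW]; decide)
  exact ⟨hmem, eq_adjoin_of_mem_of_sq_eq_neg' hmem (m := 3) (by norm_num) (by rw [sq_delta_eighteen]; norm_num) hdeg, sq_delta_eighteen, hdeg⟩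

variable {Φ : CMType L} {A : AbelianVariety ℂ} {ι : 𝓞 L →+* End A} {θ : L →+* Module.End ℂ (complexBetti A.X 1)}

/-- **`N = 18`, `W = {1, 7, 13}`: `A ∼ E^3` WITH `E` AN ELLIPTIC CURVE WITH COMPLEX MULTIPLICATION BY `𝓞_{ℚ(√−3)}`** (`K₁ = ℚ(δ)`,
`δ = 1 + 2 * ζ ^ 6`, `δ² = −3`; `𝓞_{K₁}`-equivariant isogeny onto `E^3`). [cite: KoblitzRohrlich1978, §1 p. 1184]
[cite: BauerCosteItzyksonRuelle1997, §3.3–3.4] [cite: Shimura1998, §8.2 Prop. 26, §6.2 Thm. 3] -/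
theorem exists_isIsogeny_pow_elliptic_eighteen (hA : IsCMTypeRealisation Φ A ι θ)
    (hW : ((unitResidues 18).filter fun t =>
        ∀ c ∈ unitResidues 18, (c * t ∈ residueSet 18 Φ ↔ c ∈ residueSet 18 Φ)) = {1, 7, 13}) :
    ∃ (K₁ : IntermediateField ℚ L) (Φ₁ : CMType K₁), IsCMField K₁ ∧ Module.finrank ℚ K₁ = 2 ∧
      1 + 2 * zetaOf 18 L ^ 6 ∈ K₁ ∧ K₁ = IntermediateField.adjoin ℚ {1 + 2 * zetaOf 18 L ^ 6} ∧ (1 + 2 * zetaOf 18 L ^ 6) ^ 2 = -3 ∧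
      inducedCMType (algebraMap K₁ L) Φ₁ = Φ ∧
      ∃ (E : AbelianVariety ℂ) (ιE : 𝓞 K₁ →+* End E) (θE : K₁ →+* Module.End ℂ (complexBetti E.X 1)),
        IsCMTypeRealisation Φ₁ E ιE θE ∧ E.IsSimple ∧ E.dim = 1 ∧
        ∃ (h : ℕ) (P : AbelianVariety ℂ) (π : Fin h → (P ⟶ E)), Nonempty (IsLimit (Fan.mk P π)) ∧ h = 3 ∧
          ∃ g : A ⟶ P, IsIsogeny g ∧
            ∀ (j : Fin h) (b : 𝓞 K₁), ι (RingOfIntegers.mapRingHom (algebraMap K₁ L : K₁ →+* L) b) ≫ (g ≫ π j) = (g ≫ π j) ≫ ιE b := by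
  haveI : IsCMField L := IsCyclotomicExtension.Rat.isCMField L (S := {18}) ⟨18, rfl, by norm_num⟩
  have h2W : 2 * ((unitResidues 18).filter fun t =>
        ∀ c ∈ unitResidues 18, (c * t ∈ residueSet 18 Φ ↔ c ∈ residueSet 18 Φ)).card = Nat.totient 18 := by
    rw [hW]; decide
  obtain ⟨K₁, Φ₁, hCM, hK2, h₁, hp₁, -, E, ιE, θE, hE, hs, hdE, h, P, π, hP, -, hhW, -, g, hg, hequiv⟩ :=
    exists_isIsogeny_power_elliptic_of_two_mul_card_filter (N := 18) hA h2W
  obtain ⟨hmem, hK, hsq, -⟩ := eq_adjoin_delta_eighteen Φ Φ₁ h₁ hp₁ hW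
  have hh : h = 3 := by rw [hhW, hW]; decide
  exact ⟨K₁, Φ₁, hCM, hK2, hmem, hK, hsq, h₁, E, ιE, θE, hE, hs, hdE, h, P, π, hP, hh, g, hg, hequiv⟩

namespace CyclotomicFermatCMType

/-- `H_{1,3,14} = {1, 7, 13}` modulo `18` (Koblitz's level `18`; kernel). [cite: BauerCosteItzyksonRuelle1997, §3.4] -/
theorem fermatCMType_eighteen_witness : fermatCMType 18 1 3 14 = {1, 7, 13} := by decide

/-- **The K–R type `Φ_{H_{1,3,14}}` modulo `18`: every realisation is `∼ E^3`, `E` elliptic with CM by `𝓞_{ℚ(√−3)}`.**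
[cite: KoblitzRohrlich1978, §1 p. 1184] [cite: BauerCosteItzyksonRuelle1997, §3.4] -/
theorem exists_isIsogeny_pow_elliptic_fermat_eighteen
    {hS : ∀ c : ZMod 18, c.val.Coprime 18 → (c ∈ fermatCMType 18 1 3 14 ↔ -c ∉ fermatCMType 18 1 3 14)}
    {A : AbelianVariety ℂ} {ι : 𝓞 L →+* End A} {θ : L →+* Module.End ℂ (complexBetti A.X 1)}
    (hA : IsCMTypeRealisation (cmTypeOfResidues (L := L) (fermatCMType 18 1 3 14) hS) A ι θ) :
    ∃ (K₁ : IntermediateField ℚ L) (Φ₁ : CMType K₁), IsCMField K₁ ∧ Module.finrank ℚ K₁ = 2 ∧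
      1 + 2 * zetaOf 18 L ^ 6 ∈ K₁ ∧ K₁ = IntermediateField.adjoin ℚ {1 + 2 * zetaOf 18 L ^ 6} ∧ (1 + 2 * zetaOf 18 L ^ 6) ^ 2 = -3 ∧
      inducedCMType (algebraMap K₁ L) Φ₁ = cmTypeOfResidues (L := L) (fermatCMType 18 1 3 14) hS ∧
      ∃ (E : AbelianVariety ℂ) (ιE : 𝓞 K₁ →+* End E) (θE : K₁ →+* Module.End ℂ (complexBetti E.X 1)),
        IsCMTypeRealisation Φ₁ E ιE θE ∧ E.IsSimple ∧ E.dim = 1 ∧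
        ∃ (h : ℕ) (P : AbelianVariety ℂ) (π : Fin h → (P ⟶ E)), Nonempty (IsLimit (Fan.mk P π)) ∧ h = 3 ∧
          ∃ g : A ⟶ P, IsIsogeny g ∧
            ∀ (j : Fin h) (b : 𝓞 K₁), ι (RingOfIntegers.mapRingHom (algebraMap K₁ L : K₁ →+* L) b) ≫ (g ≫ π j) = (g ≫ π j) ≫ ιE b := by
  refine exists_isIsogeny_pow_elliptic_eighteen hA ?_
  rw [residueSet_cmTypeOfResidues 18 (isCMResidueSet_fermatCMType hS), fermatCMType_eighteen_witness]
  exact stabilizerResidues_eighteen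

end CyclotomicFermatCMType

end Eighteen

/-! ## `N = 30`: `H = {1, 7, 13, 19}`, `K₁ = ℚ(1 + 2 * ζ ^ 10) = ℚ(√−3)` -/

section Thirty

variable {L : Type} [Field L] [NumberField L] [IsCyclotomicExtension {30} ℚ L]

/-- `ζ^30 = 1`. [cite: Washington1997, Ch. 2 (roots of unity)] -/
theorem zetaOf_pow_thirty : zetaOf 30 L ^ 30 = 1 := (IsCyclotomicExtension.zeta_spec 30 ℚ L).pow_eq_one

/-- **`Φ₃(ζ¹⁰) = ζ²⁰ + ζ¹⁰ + 1 = 0`** in `ℚ(ζ₃₀)`. [cite: Washington1997, Ch. 2 (cyclotomic polynomials)] -/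
theorem cyclotomic_relation_thirty : zetaOf 30 L ^ 20 + zetaOf 30 L ^ 10 + 1 = 0 := by
  have hprim : IsPrimitiveRoot (zetaOf 30 L) 30 := IsCyclotomicExtension.zeta_spec 30 ℚ L
  have h10 : zetaOf 30 L ^ 10 ≠ 1 := hprim.pow_ne_one_of_pos_of_lt (by norm_num) (by norm_num)
  have hmul : (zetaOf 30 L ^ 10 - 1) * (zetaOf 30 L ^ 20 + zetaOf 30 L ^ 10 + 1) = 0 := by
    linear_combination zetaOf_pow_thirty (L := L)
  exact (mul_eq_zero.1 hmul).resolve_left (sub_ne_zero.2 h10)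

/-- **`(1 + 2ζ¹⁰)² = −3`** in `ℚ(ζ₃₀)` (`ζ¹⁰ = ω`). [cite: Washington1997, Ch. 2] [cite: BauerCosteItzyksonRuelle1997, §3.4] -/
theorem sq_delta_thirty : (1 + 2 * zetaOf 30 L ^ 10) ^ 2 = -3 := by
  linear_combination 4 * cyclotomic_relation_thirty (L := L)

/-- `σ_h` fixes `ζ ^ 10` for every `h ∈ {1, 7, 13, 19}`, `h ≠ 1` (the exponents are permuted modulo `30`). [cite: Washington1997, Thm. 2.5] -/
theorem apply_core_thirty {σ : L ≃ₐ[ℚ] L} (hσ : autResidue 30 L σ ∈ ({7, 13, 19} : Finset (ZMod 30))) :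
    σ (zetaOf 30 L ^ 10) = zetaOf 30 L ^ 10 := by
  simp only [Finset.mem_insert, Finset.mem_singleton] at hσ
  rcases hσ with hh | hh | hh
  · have hv : (autResidue 30 L σ).val = 7 := by rw [hh]; rfl
    simp only [apply_zetaOf_pow_eq_pow_mod hv, Nat.reduceMul, Nat.reduceMod]
  · have hv : (autResidue 30 L σ).val = 13 := by rw [hh]; rfl
    simp only [apply_zetaOf_pow_eq_pow_mod hv, Nat.reduceMul, Nat.reduceMod]
  · have hv : (autResidue 30 L σ).val = 19 := by rw [hh]; rfl
    simp only [apply_zetaOf_pow_eq_pow_mod hv, Nat.reduceMul, Nat.reduceMod]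

/-- `W({1, 7, 13, 19}) = {1, 7, 13, 19}` modulo `30` (kernel). [cite: BauerCosteItzyksonRuelle1997, §3.4] -/
theorem stabilizerResidues_thirty :
    ((unitResidues 30).filter fun t => ∀ c ∈ unitResidues 30,
        (c * t ∈ ({1, 7, 13, 19} : Finset (ZMod 30)) ↔ c ∈ ({1, 7, 13, 19} : Finset (ZMod 30)))) = {1, 7, 13, 19} := by
  decide

/-- **`W = {1, 7, 13, 19}` ⟹ `K₁ = ℚ(√−3) = ℚ(1 + 2 * ζ ^ 10)`** for every CM type of `ℚ(ζ_30)` with this stabiliser and ANY primitive sub-pair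
(`1 + 2 * ζ ^ 10` is fixed by every `σ_h`, `h ∈ W`, so lies in `K₁`; its square is `−3 < 0`; `[K₁ : ℚ] = 2`).
[cite: KoblitzRohrlich1978, §1 p. 1184] [cite: BauerCosteItzyksonRuelle1997, §3.3] [cite: Shimura1998, §8.2 Prop. 26] -/
theorem eq_adjoin_delta_thirty (Φ : CMType L) {K₁ : IntermediateField ℚ L} (Φ₁ : CMType K₁)
    (h₁ : inducedCMType (algebraMap K₁ L) Φ₁ = Φ)
    (hp₁ : ∀ s t : K₁ →+* ℂ,
      (∀ τ : ℂ ≃+* ℂ, (τ : ℂ →+* ℂ).comp s ∈ Φ₁.1 ↔ (τ : ℂ →+* ℂ).comp t ∈ Φ₁.1) → s = t)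
    (hW : ((unitResidues 30).filter fun t =>
        ∀ c ∈ unitResidues 30, (c * t ∈ residueSet 30 Φ ↔ c ∈ residueSet 30 Φ)) = {1, 7, 13, 19}) :
    1 + 2 * zetaOf 30 L ^ 10 ∈ K₁ ∧ K₁ = IntermediateField.adjoin ℚ {1 + 2 * zetaOf 30 L ^ 10} ∧ (1 + 2 * zetaOf 30 L ^ 10) ^ 2 = -3 ∧
      Module.finrank ℚ K₁ = 2 := by
  have hcore : zetaOf 30 L ^ 10 ∈ K₁ := by
    refine (mem_iff_forall_autResidue_mem_of_primitive (N := 30) Φ Φ₁ h₁ hp₁ _).2 fun γ hγ => ?_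
    rw [hW, Finset.mem_insert] at hγ
    rcases hγ with h1 | hrest
    · rw [(autResidue_eq_one_iff (N := 30) γ).1 h1, AlgEquiv.one_apply]
    · exact apply_core_thirty hrest
  have h2 : (2 : L) ∈ K₁ := by exact_mod_cast IntermediateField.natCast_mem K₁ 2
  have hmem : 1 + 2 * zetaOf 30 L ^ 10 ∈ K₁ := add_mem (one_mem K₁) (mul_mem h2 hcore)
  have hdeg := finrank_eq_two_of_two_mul_card_eq (N := 30) Φ Φ₁ h₁ hp₁ (by rw [hW]; decide)
  exact ⟨hmem, eq_adjoin_of_mem_of_sq_eq_neg' hmem (m := 3) (by norm_num) (by rw [sq_delta_thirty]; norm_num) hdeg, sq_delta_thirty, hdeg⟩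

variable {Φ : CMType L} {A : AbelianVariety ℂ} {ι : 𝓞 L →+* End A} {θ : L →+* Module.End ℂ (complexBetti A.X 1)}

/-- **`N = 30`, `W = {1, 7, 13, 19}`: `A ∼ E^4` WITH `E` AN ELLIPTIC CURVE WITH COMPLEX MULTIPLICATION BY `𝓞_{ℚ(√−3)}`** (`K₁ = ℚ(δ)`,
`δ = 1 + 2 * ζ ^ 10`, `δ² = −3`; `𝓞_{K₁}`-equivariant isogeny onto `E^4`). [cite: KoblitzRohrlich1978, §1 p. 1184]
[cite: BauerCosteItzyksonRuelle1997, §3.3–3.4] [cite: Shimura1998, §8.2 Prop. 26, §6.2 Thm. 3] -/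
theorem exists_isIsogeny_pow_elliptic_thirty (hA : IsCMTypeRealisation Φ A ι θ)
    (hW : ((unitResidues 30).filter fun t =>
        ∀ c ∈ unitResidues 30, (c * t ∈ residueSet 30 Φ ↔ c ∈ residueSet 30 Φ)) = {1, 7, 13, 19}) :
    ∃ (K₁ : IntermediateField ℚ L) (Φ₁ : CMType K₁), IsCMField K₁ ∧ Module.finrank ℚ K₁ = 2 ∧
      1 + 2 * zetaOf 30 L ^ 10 ∈ K₁ ∧ K₁ = IntermediateField.adjoin ℚ {1 + 2 * zetaOf 30 L ^ 10} ∧ (1 + 2 * zetaOf 30 L ^ 10) ^ 2 = -3 ∧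
      inducedCMType (algebraMap K₁ L) Φ₁ = Φ ∧
      ∃ (E : AbelianVariety ℂ) (ιE : 𝓞 K₁ →+* End E) (θE : K₁ →+* Module.End ℂ (complexBetti E.X 1)),
        IsCMTypeRealisation Φ₁ E ιE θE ∧ E.IsSimple ∧ E.dim = 1 ∧
        ∃ (h : ℕ) (P : AbelianVariety ℂ) (π : Fin h → (P ⟶ E)), Nonempty (IsLimit (Fan.mk P π)) ∧ h = 4 ∧
          ∃ g : A ⟶ P, IsIsogeny g ∧
            ∀ (j : Fin h) (b : 𝓞 K₁), ι (RingOfIntegers.mapRingHom (algebraMap K₁ L : K₁ →+* L) b) ≫ (g ≫ π j) = (g ≫ π j) ≫ ιE b := by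
  haveI : IsCMField L := IsCyclotomicExtension.Rat.isCMField L (S := {30}) ⟨30, rfl, by norm_num⟩
  have h2W : 2 * ((unitResidues 30).filter fun t =>
        ∀ c ∈ unitResidues 30, (c * t ∈ residueSet 30 Φ ↔ c ∈ residueSet 30 Φ)).card = Nat.totient 30 := by
    rw [hW]; decide
  obtain ⟨K₁, Φ₁, hCM, hK2, h₁, hp₁, -, E, ιE, θE, hE, hs, hdE, h, P, π, hP, -, hhW, -, g, hg, hequiv⟩ :=
    exists_isIsogeny_power_elliptic_of_two_mul_card_filter (N := 30) hA h2W
  obtain ⟨hmem, hK, hsq, -⟩ := eq_adjoin_delta_thirty Φ Φ₁ h₁ hp₁ hW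
  have hh : h = 4 := by rw [hhW, hW]; decide
  exact ⟨K₁, Φ₁, hCM, hK2, hmem, hK, hsq, h₁, E, ιE, θE, hE, hs, hdE, h, P, π, hP, hh, g, hg, hequiv⟩

namespace CyclotomicFermatCMType

/-- `H_{1,5,24} = {1, 7, 13, 19}` modulo `30` (Koblitz's level `30`; kernel). [cite: BauerCosteItzyksonRuelle1997, §3.4] -/
theorem fermatCMType_thirty_witness : fermatCMType 30 1 5 24 = {1, 7, 13, 19} := by decide

/-- **The K–R type `Φ_{H_{1,5,24}}` modulo `30`: every realisation is `∼ E^4`, `E` elliptic with CM by `𝓞_{ℚ(√−3)}`.**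
[cite: KoblitzRohrlich1978, §1 p. 1184] [cite: BauerCosteItzyksonRuelle1997, §3.4] -/
theorem exists_isIsogeny_pow_elliptic_fermat_thirty
    {hS : ∀ c : ZMod 30, c.val.Coprime 30 → (c ∈ fermatCMType 30 1 5 24 ↔ -c ∉ fermatCMType 30 1 5 24)}
    {A : AbelianVariety ℂ} {ι : 𝓞 L →+* End A} {θ : L →+* Module.End ℂ (complexBetti A.X 1)}
    (hA : IsCMTypeRealisation (cmTypeOfResidues (L := L) (fermatCMType 30 1 5 24) hS) A ι θ) :
    ∃ (K₁ : IntermediateField ℚ L) (Φ₁ : CMType K₁), IsCMField K₁ ∧ Module.finrank ℚ K₁ = 2 ∧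
      1 + 2 * zetaOf 30 L ^ 10 ∈ K₁ ∧ K₁ = IntermediateField.adjoin ℚ {1 + 2 * zetaOf 30 L ^ 10} ∧ (1 + 2 * zetaOf 30 L ^ 10) ^ 2 = -3 ∧
      inducedCMType (algebraMap K₁ L) Φ₁ = cmTypeOfResidues (L := L) (fermatCMType 30 1 5 24) hS ∧
      ∃ (E : AbelianVariety ℂ) (ιE : 𝓞 K₁ →+* End E) (θE : K₁ →+* Module.End ℂ (complexBetti E.X 1)),
        IsCMTypeRealisation Φ₁ E ιE θE ∧ E.IsSimple ∧ E.dim = 1 ∧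
        ∃ (h : ℕ) (P : AbelianVariety ℂ) (π : Fin h → (P ⟶ E)), Nonempty (IsLimit (Fan.mk P π)) ∧ h = 4 ∧
          ∃ g : A ⟶ P, IsIsogeny g ∧
            ∀ (j : Fin h) (b : 𝓞 K₁), ι (RingOfIntegers.mapRingHom (algebraMap K₁ L : K₁ →+* L) b) ≫ (g ≫ π j) = (g ≫ π j) ≫ ιE b := by
  refine exists_isIsogeny_pow_elliptic_thirty hA ?_
  rw [residueSet_cmTypeOfResidues 30 (isCMResidueSet_fermatCMType hS), fermatCMType_thirty_witness]
  exact stabilizerResidues_thirty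

end CyclotomicFermatCMType

end Thirty

/-! ## `N = 40`: `H = {1, 3, 7, 9, 21, 23, 27, 29}`, `K₁ = ℚ(ζ ^ 2 + ζ ^ 6 + ζ ^ 14 + ζ ^ 18) = ℚ(√−5)` -/

section Forty

variable {L : Type} [Field L] [NumberField L] [IsCyclotomicExtension {40} ℚ L]

/-- `ζ^40 = 1`. [cite: Washington1997, Ch. 2 (roots of unity)] -/
theorem zetaOf_pow_forty : zetaOf 40 L ^ 40 = 1 := (IsCyclotomicExtension.zeta_spec 40 ℚ L).pow_eq_one

/-- `ζ^20 = −1` in `ℚ(ζ_40)`. [cite: Washington1997, Ch. 2 (roots of unity)] -/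
theorem zetaOf_pow_half_forty : zetaOf 40 L ^ 20 = -1 :=
  ((IsCyclotomicExtension.zeta_spec 40 ℚ L).pow (by norm_num) (show 40 = 20 * 2 by norm_num)).eq_neg_one_of_two_right

/-- **`Φ₂₀(ζ²) = ζ¹⁶ − ζ¹² + ζ⁸ − ζ⁴ + 1 = 0`** in `ℚ(ζ₄₀)` (`x = ζ⁴`: `x⁵ = −1`, `x ≠ −1`). [cite: Washington1997, Ch. 2 (cyclotomic polynomials)] -/
theorem cyclotomic_relation_forty : zetaOf 40 L ^ 16 - zetaOf 40 L ^ 12 + zetaOf 40 L ^ 8 - zetaOf 40 L ^ 4 + 1 = 0 := by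
  have hprim : IsPrimitiveRoot (zetaOf 40 L) 40 := IsCyclotomicExtension.zeta_spec 40 ℚ L
  have h8 : zetaOf 40 L ^ 8 ≠ 1 := hprim.pow_ne_one_of_pos_of_lt (by norm_num) (by norm_num)
  have hne : zetaOf 40 L ^ 4 + 1 ≠ 0 := by
    intro h
    apply h8
    have h4 : zetaOf 40 L ^ 4 = -1 := eq_neg_of_add_eq_zero_left h
    rw [show (8 : ℕ) = 4 * 2 from rfl, pow_mul, h4]
    norm_num
  have hmul : (zetaOf 40 L ^ 4 + 1) * (zetaOf 40 L ^ 16 - zetaOf 40 L ^ 12 + zetaOf 40 L ^ 8 - zetaOf 40 L ^ 4 + 1) = 0 := by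
    linear_combination zetaOf_pow_half_forty (L := L)
  exact (mul_eq_zero.1 hmul).resolve_left hne

/-- **`(ζ² + ζ⁶ + ζ¹⁴ + ζ¹⁸)² = −5`** in `ℚ(ζ₄₀)` (the level-`20` period in `ζ² = ζ₂₀`). [cite: Washington1997, Ch. 2] [cite: BauerCosteItzyksonRuelle1997, §3.4] -/
theorem sq_delta_forty : (zetaOf 40 L ^ 2 + zetaOf 40 L ^ 6 + zetaOf 40 L ^ 14 + zetaOf 40 L ^ 18) ^ 2 = -5 := by
  linear_combination (zetaOf 40 L ^ 16 + 2 * zetaOf 40 L ^ 12 + zetaOf 40 L ^ 8 + 2 * zetaOf 40 L ^ 4 + 4) * zetaOf_pow_half_forty (L := L) +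
    cyclotomic_relation_forty (L := L)

/-- `σ_h` fixes `ζ ^ 2 + ζ ^ 6 + ζ ^ 14 + ζ ^ 18` for every `h ∈ {1, 3, 7, 9, 21, 23, 27, 29}`, `h ≠ 1` (the exponents are permuted modulo `40`). [cite: Washington1997, Thm. 2.5] -/
theorem apply_core_forty {σ : L ≃ₐ[ℚ] L} (hσ : autResidue 40 L σ ∈ ({3, 7, 9, 21, 23, 27, 29} : Finset (ZMod 40))) :
    σ (zetaOf 40 L ^ 2 + zetaOf 40 L ^ 6 + zetaOf 40 L ^ 14 + zetaOf 40 L ^ 18) = zetaOf 40 L ^ 2 + zetaOf 40 L ^ 6 + zetaOf 40 L ^ 14 + zetaOf 40 L ^ 18 := by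
  simp only [Finset.mem_insert, Finset.mem_singleton] at hσ
  rcases hσ with hh | hh | hh | hh | hh | hh | hh
  · have hv : (autResidue 40 L σ).val = 3 := by rw [hh]; rfl
    simp only [map_add, apply_zetaOf_pow_eq_pow_mod hv, Nat.reduceMul, Nat.reduceMod]
    ring
  · have hv : (autResidue 40 L σ).val = 7 := by rw [hh]; rfl
    simp only [map_add, apply_zetaOf_pow_eq_pow_mod hv, Nat.reduceMul, Nat.reduceMod]
    ring
  · have hv : (autResidue 40 L σ).val = 9 := by rw [hh]; rfl
    simp only [map_add, apply_zetaOf_pow_eq_pow_mod hv, Nat.reduceMul, Nat.reduceMod]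
    ring
  · have hv : (autResidue 40 L σ).val = 21 := by rw [hh]; rfl
    simp only [map_add, apply_zetaOf_pow_eq_pow_mod hv, Nat.reduceMul, Nat.reduceMod]
  · have hv : (autResidue 40 L σ).val = 23 := by rw [hh]; rfl
    simp only [map_add, apply_zetaOf_pow_eq_pow_mod hv, Nat.reduceMul, Nat.reduceMod]
    ring
  · have hv : (autResidue 40 L σ).val = 27 := by rw [hh]; rfl
    simp only [map_add, apply_zetaOf_pow_eq_pow_mod hv, Nat.reduceMul, Nat.reduceMod]
    ring
  · have hv : (autResidue 40 L σ).val = 29 := by rw [hh]; rfl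
    simp only [map_add, apply_zetaOf_pow_eq_pow_mod hv, Nat.reduceMul, Nat.reduceMod]
    ring

/-- `W({1, 3, 7, 9, 21, 23, 27, 29}) = {1, 3, 7, 9, 21, 23, 27, 29}` modulo `40` (kernel). [cite: BauerCosteItzyksonRuelle1997, §3.4] -/
theorem stabilizerResidues_forty :
    ((unitResidues 40).filter fun t => ∀ c ∈ unitResidues 40,
        (c * t ∈ ({1, 3, 7, 9, 21, 23, 27, 29} : Finset (ZMod 40)) ↔ c ∈ ({1, 3, 7, 9, 21, 23, 27, 29} : Finset (ZMod 40)))) = {1, 3, 7, 9, 21, 23, 27, 29} := by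
  decide

/-- **`W = {1, 3, 7, 9, 21, 23, 27, 29}` ⟹ `K₁ = ℚ(√−5) = ℚ(ζ ^ 2 + ζ ^ 6 + ζ ^ 14 + ζ ^ 18)`** for every CM type of `ℚ(ζ_40)` with this stabiliser and ANY primitive sub-pair
(`ζ ^ 2 + ζ ^ 6 + ζ ^ 14 + ζ ^ 18` is fixed by every `σ_h`, `h ∈ W`, so lies in `K₁`; its square is `−5 < 0`; `[K₁ : ℚ] = 2`).
[cite: KoblitzRohrlich1978, §1 p. 1184] [cite: BauerCosteItzyksonRuelle1997, §3.3] [cite: Shimura1998, §8.2 Prop. 26] -/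
theorem eq_adjoin_delta_forty (Φ : CMType L) {K₁ : IntermediateField ℚ L} (Φ₁ : CMType K₁)
    (h₁ : inducedCMType (algebraMap K₁ L) Φ₁ = Φ)
    (hp₁ : ∀ s t : K₁ →+* ℂ,
      (∀ τ : ℂ ≃+* ℂ, (τ : ℂ →+* ℂ).comp s ∈ Φ₁.1 ↔ (τ : ℂ →+* ℂ).comp t ∈ Φ₁.1) → s = t)
    (hW : ((unitResidues 40).filter fun t =>
        ∀ c ∈ unitResidues 40, (c * t ∈ residueSet 40 Φ ↔ c ∈ residueSet 40 Φ)) = {1, 3, 7, 9, 21, 23, 27, 29}) :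
    zetaOf 40 L ^ 2 + zetaOf 40 L ^ 6 + zetaOf 40 L ^ 14 + zetaOf 40 L ^ 18 ∈ K₁ ∧ K₁ = IntermediateField.adjoin ℚ {zetaOf 40 L ^ 2 + zetaOf 40 L ^ 6 + zetaOf 40 L ^ 14 + zetaOf 40 L ^ 18} ∧ (zetaOf 40 L ^ 2 + zetaOf 40 L ^ 6 + zetaOf 40 L ^ 14 + zetaOf 40 L ^ 18) ^ 2 = -5 ∧
      Module.finrank ℚ K₁ = 2 := by
  have hcore : zetaOf 40 L ^ 2 + zetaOf 40 L ^ 6 + zetaOf 40 L ^ 14 + zetaOf 40 L ^ 18 ∈ K₁ := by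
    refine (mem_iff_forall_autResidue_mem_of_primitive (N := 40) Φ Φ₁ h₁ hp₁ _).2 fun γ hγ => ?_
    rw [hW, Finset.mem_insert] at hγ
    rcases hγ with h1 | hrest
    · rw [(autResidue_eq_one_iff (N := 40) γ).1 h1, AlgEquiv.one_apply]
    · exact apply_core_forty hrest
  have hmem := hcore
  have hdeg := finrank_eq_two_of_two_mul_card_eq (N := 40) Φ Φ₁ h₁ hp₁ (by rw [hW]; decide)
  exact ⟨hmem, eq_adjoin_of_mem_of_sq_eq_neg' hmem (m := 5) (by norm_num) (by rw [sq_delta_forty]; norm_num) hdeg, sq_delta_forty, hdeg⟩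

variable {Φ : CMType L} {A : AbelianVariety ℂ} {ι : 𝓞 L →+* End A} {θ : L →+* Module.End ℂ (complexBetti A.X 1)}

/-- **`N = 40`, `W = {1, 3, 7, 9, 21, 23, 27, 29}`: `A ∼ E^8` WITH `E` AN ELLIPTIC CURVE WITH COMPLEX MULTIPLICATION BY `𝓞_{ℚ(√−5)}`** (`K₁ = ℚ(δ)`,
`δ = ζ ^ 2 + ζ ^ 6 + ζ ^ 14 + ζ ^ 18`, `δ² = −5`; `𝓞_{K₁}`-equivariant isogeny onto `E^8`). [cite: KoblitzRohrlich1978, §1 p. 1184]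
[cite: BauerCosteItzyksonRuelle1997, §3.3–3.4] [cite: Shimura1998, §8.2 Prop. 26, §6.2 Thm. 3] -/
theorem exists_isIsogeny_pow_elliptic_forty (hA : IsCMTypeRealisation Φ A ι θ)
    (hW : ((unitResidues 40).filter fun t =>
        ∀ c ∈ unitResidues 40, (c * t ∈ residueSet 40 Φ ↔ c ∈ residueSet 40 Φ)) = {1, 3, 7, 9, 21, 23, 27, 29}) :
    ∃ (K₁ : IntermediateField ℚ L) (Φ₁ : CMType K₁), IsCMField K₁ ∧ Module.finrank ℚ K₁ = 2 ∧
      zetaOf 40 L ^ 2 + zetaOf 40 L ^ 6 + zetaOf 40 L ^ 14 + zetaOf 40 L ^ 18 ∈ K₁ ∧ K₁ = IntermediateField.adjoin ℚ {zetaOf 40 L ^ 2 + zetaOf 40 L ^ 6 + zetaOf 40 L ^ 14 + zetaOf 40 L ^ 18} ∧ (zetaOf 40 L ^ 2 + zetaOf 40 L ^ 6 + zetaOf 40 L ^ 14 + zetaOf 40 L ^ 18) ^ 2 = -5 ∧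
      inducedCMType (algebraMap K₁ L) Φ₁ = Φ ∧
      ∃ (E : AbelianVariety ℂ) (ιE : 𝓞 K₁ →+* End E) (θE : K₁ →+* Module.End ℂ (complexBetti E.X 1)),
        IsCMTypeRealisation Φ₁ E ιE θE ∧ E.IsSimple ∧ E.dim = 1 ∧
        ∃ (h : ℕ) (P : AbelianVariety ℂ) (π : Fin h → (P ⟶ E)), Nonempty (IsLimit (Fan.mk P π)) ∧ h = 8 ∧
          ∃ g : A ⟶ P, IsIsogeny g ∧
            ∀ (j : Fin h) (b : 𝓞 K₁), ι (RingOfIntegers.mapRingHom (algebraMap K₁ L : K₁ →+* L) b) ≫ (g ≫ π j) = (g ≫ π j) ≫ ιE b := by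
  haveI : IsCMField L := IsCyclotomicExtension.Rat.isCMField L (S := {40}) ⟨40, rfl, by norm_num⟩
  have h2W : 2 * ((unitResidues 40).filter fun t =>
        ∀ c ∈ unitResidues 40, (c * t ∈ residueSet 40 Φ ↔ c ∈ residueSet 40 Φ)).card = Nat.totient 40 := by
    rw [hW]; decide
  obtain ⟨K₁, Φ₁, hCM, hK2, h₁, hp₁, -, E, ιE, θE, hE, hs, hdE, h, P, π, hP, -, hhW, -, g, hg, hequiv⟩ :=
    exists_isIsogeny_power_elliptic_of_two_mul_card_filter (N := 40) hA h2W
  obtain ⟨hmem, hK, hsq, -⟩ := eq_adjoin_delta_forty Φ Φ₁ h₁ hp₁ hW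
  have hh : h = 8 := by rw [hhW, hW]; decide
  exact ⟨K₁, Φ₁, hCM, hK2, hmem, hK, hsq, h₁, E, ιE, θE, hE, hs, hdE, h, P, π, hP, hh, g, hg, hequiv⟩

namespace CyclotomicFermatCMType

/-- `H_{1,18,21} = {1, 3, 7, 9, 21, 23, 27, 29}` modulo `40` (Koblitz's level `40`; kernel). [cite: BauerCosteItzyksonRuelle1997, §3.4] -/
theorem fermatCMType_forty_witness : fermatCMType 40 1 18 21 = {1, 3, 7, 9, 21, 23, 27, 29} := by decide

/-- **The K–R type `Φ_{H_{1,18,21}}` modulo `40`: every realisation is `∼ E^8`, `E` elliptic with CM by `𝓞_{ℚ(√−5)}`.**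
[cite: KoblitzRohrlich1978, §1 p. 1184] [cite: BauerCosteItzyksonRuelle1997, §3.4] -/
theorem exists_isIsogeny_pow_elliptic_fermat_forty
    {hS : ∀ c : ZMod 40, c.val.Coprime 40 → (c ∈ fermatCMType 40 1 18 21 ↔ -c ∉ fermatCMType 40 1 18 21)}
    {A : AbelianVariety ℂ} {ι : 𝓞 L →+* End A} {θ : L →+* Module.End ℂ (complexBetti A.X 1)}
    (hA : IsCMTypeRealisation (cmTypeOfResidues (L := L) (fermatCMType 40 1 18 21) hS) A ι θ) :
    ∃ (K₁ : IntermediateField ℚ L) (Φ₁ : CMType K₁), IsCMField K₁ ∧ Module.finrank ℚ K₁ = 2 ∧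
      zetaOf 40 L ^ 2 + zetaOf 40 L ^ 6 + zetaOf 40 L ^ 14 + zetaOf 40 L ^ 18 ∈ K₁ ∧ K₁ = IntermediateField.adjoin ℚ {zetaOf 40 L ^ 2 + zetaOf 40 L ^ 6 + zetaOf 40 L ^ 14 + zetaOf 40 L ^ 18} ∧ (zetaOf 40 L ^ 2 + zetaOf 40 L ^ 6 + zetaOf 40 L ^ 14 + zetaOf 40 L ^ 18) ^ 2 = -5 ∧
      inducedCMType (algebraMap K₁ L) Φ₁ = cmTypeOfResidues (L := L) (fermatCMType 40 1 18 21) hS ∧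
      ∃ (E : AbelianVariety ℂ) (ιE : 𝓞 K₁ →+* End E) (θE : K₁ →+* Module.End ℂ (complexBetti E.X 1)),
        IsCMTypeRealisation Φ₁ E ιE θE ∧ E.IsSimple ∧ E.dim = 1 ∧
        ∃ (h : ℕ) (P : AbelianVariety ℂ) (π : Fin h → (P ⟶ E)), Nonempty (IsLimit (Fan.mk P π)) ∧ h = 8 ∧
          ∃ g : A ⟶ P, IsIsogeny g ∧
            ∀ (j : Fin h) (b : 𝓞 K₁), ι (RingOfIntegers.mapRingHom (algebraMap K₁ L : K₁ →+* L) b) ≫ (g ≫ π j) = (g ≫ π j) ≫ ιE b := by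
  refine exists_isIsogeny_pow_elliptic_forty hA ?_
  rw [residueSet_cmTypeOfResidues 40 (isCMResidueSet_fermatCMType hS), fermatCMType_forty_witness]
  exact stabilizerResidues_forty

end CyclotomicFermatCMType

end Forty

/-! ## `N = 48`: `H = {1, 5, 7, 11, 25, 29, 31, 35}`, `K₁ = ℚ(ζ ^ 2 + ζ ^ 10 + ζ ^ 14 + ζ ^ 22) = ℚ(√−6)` -/

section FortyEight

variable {L : Type} [Field L] [NumberField L] [IsCyclotomicExtension {48} ℚ L]

/-- `ζ^48 = 1`. [cite: Washington1997, Ch. 2 (roots of unity)] -/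
theorem zetaOf_pow_fortyEight : zetaOf 48 L ^ 48 = 1 := (IsCyclotomicExtension.zeta_spec 48 ℚ L).pow_eq_one

/-- `ζ^24 = −1` in `ℚ(ζ_48)`. [cite: Washington1997, Ch. 2 (roots of unity)] -/
theorem zetaOf_pow_half_fortyEight : zetaOf 48 L ^ 24 = -1 :=
  ((IsCyclotomicExtension.zeta_spec 48 ℚ L).pow (by norm_num) (show 48 = 24 * 2 by norm_num)).eq_neg_one_of_two_right

/-- **`Φ₂₄(ζ²) = ζ¹⁶ − ζ⁸ + 1 = 0`** in `ℚ(ζ₄₈)` (`x = ζ⁸`: `x³ = −1`, `x ≠ −1`). [cite: Washington1997, Ch. 2 (cyclotomic polynomials)] -/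
theorem cyclotomic_relation_fortyEight : zetaOf 48 L ^ 16 - zetaOf 48 L ^ 8 + 1 = 0 := by
  have hprim : IsPrimitiveRoot (zetaOf 48 L) 48 := IsCyclotomicExtension.zeta_spec 48 ℚ L
  have h16 : zetaOf 48 L ^ 16 ≠ 1 := hprim.pow_ne_one_of_pos_of_lt (by norm_num) (by norm_num)
  have hne : zetaOf 48 L ^ 8 + 1 ≠ 0 := by
    intro h
    apply h16
    have h8 : zetaOf 48 L ^ 8 = -1 := eq_neg_of_add_eq_zero_left h
    rw [show (16 : ℕ) = 8 * 2 from rfl, pow_mul, h8]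
    norm_num
  have hmul : (zetaOf 48 L ^ 8 + 1) * (zetaOf 48 L ^ 16 - zetaOf 48 L ^ 8 + 1) = 0 := by
    linear_combination zetaOf_pow_half_fortyEight (L := L)
  exact (mul_eq_zero.1 hmul).resolve_left hne

/-- **`(ζ² + ζ¹⁰ + ζ¹⁴ + ζ²²)² = −6`** in `ℚ(ζ₄₈)` (the level-`24` Gauss period in `ζ² = ζ₂₄`). [cite: Washington1997, Ch. 2] [cite: BauerCosteItzyksonRuelle1997, §3.4] -/
theorem sq_delta_fortyEight : (zetaOf 48 L ^ 2 + zetaOf 48 L ^ 10 + zetaOf 48 L ^ 14 + zetaOf 48 L ^ 22) ^ 2 = -6 := by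
  linear_combination (zetaOf 48 L ^ 20 + zetaOf 48 L ^ 4 + 2 * zetaOf 48 L ^ 12 + 2 * zetaOf 48 L ^ 8 + 4) * zetaOf_pow_half_fortyEight (L := L) +
    2 * cyclotomic_relation_fortyEight (L := L)

/-- `σ_h` fixes `ζ ^ 2 + ζ ^ 10 + ζ ^ 14 + ζ ^ 22` for every `h ∈ {1, 5, 7, 11, 25, 29, 31, 35}`, `h ≠ 1` (the exponents are permuted modulo `48`). [cite: Washington1997, Thm. 2.5] -/
theorem apply_core_fortyEight {σ : L ≃ₐ[ℚ] L} (hσ : autResidue 48 L σ ∈ ({5, 7, 11, 25, 29, 31, 35} : Finset (ZMod 48))) :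
    σ (zetaOf 48 L ^ 2 + zetaOf 48 L ^ 10 + zetaOf 48 L ^ 14 + zetaOf 48 L ^ 22) = zetaOf 48 L ^ 2 + zetaOf 48 L ^ 10 + zetaOf 48 L ^ 14 + zetaOf 48 L ^ 22 := by
  simp only [Finset.mem_insert, Finset.mem_singleton] at hσ
  rcases hσ with hh | hh | hh | hh | hh | hh | hh
  · have hv : (autResidue 48 L σ).val = 5 := by rw [hh]; rfl
    simp only [map_add, apply_zetaOf_pow_eq_pow_mod hv, Nat.reduceMul, Nat.reduceMod]
    ring
  · have hv : (autResidue 48 L σ).val = 7 := by rw [hh]; rfl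
    simp only [map_add, apply_zetaOf_pow_eq_pow_mod hv, Nat.reduceMul, Nat.reduceMod]
    ring
  · have hv : (autResidue 48 L σ).val = 11 := by rw [hh]; rfl
    simp only [map_add, apply_zetaOf_pow_eq_pow_mod hv, Nat.reduceMul, Nat.reduceMod]
    ring
  · have hv : (autResidue 48 L σ).val = 25 := by rw [hh]; rfl
    simp only [map_add, apply_zetaOf_pow_eq_pow_mod hv, Nat.reduceMul, Nat.reduceMod]
  · have hv : (autResidue 48 L σ).val = 29 := by rw [hh]; rfl
    simp only [map_add, apply_zetaOf_pow_eq_pow_mod hv, Nat.reduceMul, Nat.reduceMod]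
    ring
  · have hv : (autResidue 48 L σ).val = 31 := by rw [hh]; rfl
    simp only [map_add, apply_zetaOf_pow_eq_pow_mod hv, Nat.reduceMul, Nat.reduceMod]
    ring
  · have hv : (autResidue 48 L σ).val = 35 := by rw [hh]; rfl
    simp only [map_add, apply_zetaOf_pow_eq_pow_mod hv, Nat.reduceMul, Nat.reduceMod]
    ring

/-- `W({1, 5, 7, 11, 25, 29, 31, 35}) = {1, 5, 7, 11, 25, 29, 31, 35}` modulo `48` (kernel). [cite: BauerCosteItzyksonRuelle1997, §3.4] -/
theorem stabilizerResidues_fortyEight :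
    ((unitResidues 48).filter fun t => ∀ c ∈ unitResidues 48,
        (c * t ∈ ({1, 5, 7, 11, 25, 29, 31, 35} : Finset (ZMod 48)) ↔ c ∈ ({1, 5, 7, 11, 25, 29, 31, 35} : Finset (ZMod 48)))) = {1, 5, 7, 11, 25, 29, 31, 35} := by
  decide

/-- **`W = {1, 5, 7, 11, 25, 29, 31, 35}` ⟹ `K₁ = ℚ(√−6) = ℚ(ζ ^ 2 + ζ ^ 10 + ζ ^ 14 + ζ ^ 22)`** for every CM type of `ℚ(ζ_48)` with this stabiliser and ANY primitive sub-pair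
(`ζ ^ 2 + ζ ^ 10 + ζ ^ 14 + ζ ^ 22` is fixed by every `σ_h`, `h ∈ W`, so lies in `K₁`; its square is `−6 < 0`; `[K₁ : ℚ] = 2`).
[cite: KoblitzRohrlich1978, §1 p. 1184] [cite: BauerCosteItzyksonRuelle1997, §3.3] [cite: Shimura1998, §8.2 Prop. 26] -/
theorem eq_adjoin_delta_fortyEight (Φ : CMType L) {K₁ : IntermediateField ℚ L} (Φ₁ : CMType K₁)
    (h₁ : inducedCMType (algebraMap K₁ L) Φ₁ = Φ)
    (hp₁ : ∀ s t : K₁ →+* ℂ,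
      (∀ τ : ℂ ≃+* ℂ, (τ : ℂ →+* ℂ).comp s ∈ Φ₁.1 ↔ (τ : ℂ →+* ℂ).comp t ∈ Φ₁.1) → s = t)
    (hW : ((unitResidues 48).filter fun t =>
        ∀ c ∈ unitResidues 48, (c * t ∈ residueSet 48 Φ ↔ c ∈ residueSet 48 Φ)) = {1, 5, 7, 11, 25, 29, 31, 35}) :
    zetaOf 48 L ^ 2 + zetaOf 48 L ^ 10 + zetaOf 48 L ^ 14 + zetaOf 48 L ^ 22 ∈ K₁ ∧ K₁ = IntermediateField.adjoin ℚ {zetaOf 48 L ^ 2 + zetaOf 48 L ^ 10 + zetaOf 48 L ^ 14 + zetaOf 48 L ^ 22} ∧ (zetaOf 48 L ^ 2 + zetaOf 48 L ^ 10 + zetaOf 48 L ^ 14 + zetaOf 48 L ^ 22) ^ 2 = -6 ∧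
      Module.finrank ℚ K₁ = 2 := by
  have hcore : zetaOf 48 L ^ 2 + zetaOf 48 L ^ 10 + zetaOf 48 L ^ 14 + zetaOf 48 L ^ 22 ∈ K₁ := by
    refine (mem_iff_forall_autResidue_mem_of_primitive (N := 48) Φ Φ₁ h₁ hp₁ _).2 fun γ hγ => ?_
    rw [hW, Finset.mem_insert] at hγ
    rcases hγ with h1 | hrest
    · rw [(autResidue_eq_one_iff (N := 48) γ).1 h1, AlgEquiv.one_apply]
    · exact apply_core_fortyEight hrest
  have hmem := hcore
  have hdeg := finrank_eq_two_of_two_mul_card_eq (N := 48) Φ Φ₁ h₁ hp₁ (by rw [hW]; decide)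
  exact ⟨hmem, eq_adjoin_of_mem_of_sq_eq_neg' hmem (m := 6) (by norm_num) (by rw [sq_delta_fortyEight]; norm_num) hdeg, sq_delta_fortyEight, hdeg⟩

variable {Φ : CMType L} {A : AbelianVariety ℂ} {ι : 𝓞 L →+* End A} {θ : L →+* Module.End ℂ (complexBetti A.X 1)}

/-- **`N = 48`, `W = {1, 5, 7, 11, 25, 29, 31, 35}`: `A ∼ E^8` WITH `E` AN ELLIPTIC CURVE WITH COMPLEX MULTIPLICATION BY `𝓞_{ℚ(√−6)}`** (`K₁ = ℚ(δ)`,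
`δ = ζ ^ 2 + ζ ^ 10 + ζ ^ 14 + ζ ^ 22`, `δ² = −6`; `𝓞_{K₁}`-equivariant isogeny onto `E^8`). [cite: KoblitzRohrlich1978, §1 p. 1184]
[cite: BauerCosteItzyksonRuelle1997, §3.3–3.4] [cite: Shimura1998, §8.2 Prop. 26, §6.2 Thm. 3] -/
theorem exists_isIsogeny_pow_elliptic_fortyEight (hA : IsCMTypeRealisation Φ A ι θ)
    (hW : ((unitResidues 48).filter fun t =>
        ∀ c ∈ unitResidues 48, (c * t ∈ residueSet 48 Φ ↔ c ∈ residueSet 48 Φ)) = {1, 5, 7, 11, 25, 29, 31, 35}) :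
    ∃ (K₁ : IntermediateField ℚ L) (Φ₁ : CMType K₁), IsCMField K₁ ∧ Module.finrank ℚ K₁ = 2 ∧
      zetaOf 48 L ^ 2 + zetaOf 48 L ^ 10 + zetaOf 48 L ^ 14 + zetaOf 48 L ^ 22 ∈ K₁ ∧ K₁ = IntermediateField.adjoin ℚ {zetaOf 48 L ^ 2 + zetaOf 48 L ^ 10 + zetaOf 48 L ^ 14 + zetaOf 48 L ^ 22} ∧ (zetaOf 48 L ^ 2 + zetaOf 48 L ^ 10 + zetaOf 48 L ^ 14 + zetaOf 48 L ^ 22) ^ 2 = -6 ∧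
      inducedCMType (algebraMap K₁ L) Φ₁ = Φ ∧
      ∃ (E : AbelianVariety ℂ) (ιE : 𝓞 K₁ →+* End E) (θE : K₁ →+* Module.End ℂ (complexBetti E.X 1)),
        IsCMTypeRealisation Φ₁ E ιE θE ∧ E.IsSimple ∧ E.dim = 1 ∧
        ∃ (h : ℕ) (P : AbelianVariety ℂ) (π : Fin h → (P ⟶ E)), Nonempty (IsLimit (Fan.mk P π)) ∧ h = 8 ∧
          ∃ g : A ⟶ P, IsIsogeny g ∧
            ∀ (j : Fin h) (b : 𝓞 K₁), ι (RingOfIntegers.mapRingHom (algebraMap K₁ L : K₁ →+* L) b) ≫ (g ≫ π j) = (g ≫ π j) ≫ ιE b := by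
  haveI : IsCMField L := IsCyclotomicExtension.Rat.isCMField L (S := {48}) ⟨48, rfl, by norm_num⟩
  have h2W : 2 * ((unitResidues 48).filter fun t =>
        ∀ c ∈ unitResidues 48, (c * t ∈ residueSet 48 Φ ↔ c ∈ residueSet 48 Φ)).card = Nat.totient 48 := by
    rw [hW]; decide
  obtain ⟨K₁, Φ₁, hCM, hK2, h₁, hp₁, -, E, ιE, θE, hE, hs, hdE, h, P, π, hP, -, hhW, -, g, hg, hequiv⟩ :=
    exists_isIsogeny_power_elliptic_of_two_mul_card_filter (N := 48) hA h2W
  obtain ⟨hmem, hK, hsq, -⟩ := eq_adjoin_delta_fortyEight Φ Φ₁ h₁ hp₁ hW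
  have hh : h = 8 := by rw [hhW, hW]; decide
  exact ⟨K₁, Φ₁, hCM, hK2, hmem, hK, hsq, h₁, E, ιE, θE, hE, hs, hdE, h, P, π, hP, hh, g, hg, hequiv⟩

namespace CyclotomicFermatCMType

/-- `H_{1,22,25} = {1, 5, 7, 11, 25, 29, 31, 35}` modulo `48` (Koblitz's level `48`; kernel). [cite: BauerCosteItzyksonRuelle1997, §3.4] -/
theorem fermatCMType_fortyEight_witness : fermatCMType 48 1 22 25 = {1, 5, 7, 11, 25, 29, 31, 35} := by decide

/-- **The K–R type `Φ_{H_{1,22,25}}` modulo `48`: every realisation is `∼ E^8`, `E` elliptic with CM by `𝓞_{ℚ(√−6)}`.**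
[cite: KoblitzRohrlich1978, §1 p. 1184] [cite: BauerCosteItzyksonRuelle1997, §3.4] -/
theorem exists_isIsogeny_pow_elliptic_fermat_fortyEight
    {hS : ∀ c : ZMod 48, c.val.Coprime 48 → (c ∈ fermatCMType 48 1 22 25 ↔ -c ∉ fermatCMType 48 1 22 25)}
    {A : AbelianVariety ℂ} {ι : 𝓞 L →+* End A} {θ : L →+* Module.End ℂ (complexBetti A.X 1)}
    (hA : IsCMTypeRealisation (cmTypeOfResidues (L := L) (fermatCMType 48 1 22 25) hS) A ι θ) :
    ∃ (K₁ : IntermediateField ℚ L) (Φ₁ : CMType K₁), IsCMField K₁ ∧ Module.finrank ℚ K₁ = 2 ∧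
      zetaOf 48 L ^ 2 + zetaOf 48 L ^ 10 + zetaOf 48 L ^ 14 + zetaOf 48 L ^ 22 ∈ K₁ ∧ K₁ = IntermediateField.adjoin ℚ {zetaOf 48 L ^ 2 + zetaOf 48 L ^ 10 + zetaOf 48 L ^ 14 + zetaOf 48 L ^ 22} ∧ (zetaOf 48 L ^ 2 + zetaOf 48 L ^ 10 + zetaOf 48 L ^ 14 + zetaOf 48 L ^ 22) ^ 2 = -6 ∧
      inducedCMType (algebraMap K₁ L) Φ₁ = cmTypeOfResidues (L := L) (fermatCMType 48 1 22 25) hS ∧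
      ∃ (E : AbelianVariety ℂ) (ιE : 𝓞 K₁ →+* End E) (θE : K₁ →+* Module.End ℂ (complexBetti E.X 1)),
        IsCMTypeRealisation Φ₁ E ιE θE ∧ E.IsSimple ∧ E.dim = 1 ∧
        ∃ (h : ℕ) (P : AbelianVariety ℂ) (π : Fin h → (P ⟶ E)), Nonempty (IsLimit (Fan.mk P π)) ∧ h = 8 ∧
          ∃ g : A ⟶ P, IsIsogeny g ∧
            ∀ (j : Fin h) (b : 𝓞 K₁), ι (RingOfIntegers.mapRingHom (algebraMap K₁ L : K₁ →+* L) b) ≫ (g ≫ π j) = (g ≫ π j) ≫ ιE b := by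
  refine exists_isIsogeny_pow_elliptic_fortyEight hA ?_
  rw [residueSet_cmTypeOfResidues 48 (isCMResidueSet_fermatCMType hS), fermatCMType_fortyEight_witness]
  exact stabilizerResidues_fortyEight

end CyclotomicFermatCMType

end FortyEight

/-! ## `N = 60`: `H = {1, 7, 13, 19, 31, 37, 43, 49}`, `K₁ = ℚ(1 + 2 * ζ ^ 20) = ℚ(√−3)` -/

section Sixty

variable {L : Type} [Field L] [NumberField L] [IsCyclotomicExtension {60} ℚ L]

/-- `ζ^60 = 1`. [cite: Washington1997, Ch. 2 (roots of unity)] -/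
theorem zetaOf_pow_sixty : zetaOf 60 L ^ 60 = 1 := (IsCyclotomicExtension.zeta_spec 60 ℚ L).pow_eq_one

/-- **`Φ₃(ζ²⁰) = ζ⁴⁰ + ζ²⁰ + 1 = 0`** in `ℚ(ζ₆₀)`. [cite: Washington1997, Ch. 2 (cyclotomic polynomials)] -/
theorem cyclotomic_relation_sixty : zetaOf 60 L ^ 40 + zetaOf 60 L ^ 20 + 1 = 0 := by
  have hprim : IsPrimitiveRoot (zetaOf 60 L) 60 := IsCyclotomicExtension.zeta_spec 60 ℚ L
  have h20 : zetaOf 60 L ^ 20 ≠ 1 := hprim.pow_ne_one_of_pos_of_lt (by norm_num) (by norm_num)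
  have hmul : (zetaOf 60 L ^ 20 - 1) * (zetaOf 60 L ^ 40 + zetaOf 60 L ^ 20 + 1) = 0 := by
    linear_combination zetaOf_pow_sixty (L := L)
  exact (mul_eq_zero.1 hmul).resolve_left (sub_ne_zero.2 h20)

/-- **`(1 + 2ζ²⁰)² = −3`** in `ℚ(ζ₆₀)` (`ζ²⁰ = ω`). [cite: Washington1997, Ch. 2] [cite: BauerCosteItzyksonRuelle1997, §3.4] -/
theorem sq_delta_sixty : (1 + 2 * zetaOf 60 L ^ 20) ^ 2 = -3 := by
  linear_combination 4 * cyclotomic_relation_sixty (L := L)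

/-- `σ_h` fixes `ζ ^ 20` for every `h ∈ {1, 7, 13, 19, 31, 37, 43, 49}`, `h ≠ 1` (the exponents are permuted modulo `60`). [cite: Washington1997, Thm. 2.5] -/
theorem apply_core_sixty {σ : L ≃ₐ[ℚ] L} (hσ : autResidue 60 L σ ∈ ({7, 13, 19, 31, 37, 43, 49} : Finset (ZMod 60))) :
    σ (zetaOf 60 L ^ 20) = zetaOf 60 L ^ 20 := by
  simp only [Finset.mem_insert, Finset.mem_singleton] at hσ
  rcases hσ with hh | hh | hh | hh | hh | hh | hh
  · have hv : (autResidue 60 L σ).val = 7 := by rw [hh]; rfl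
    simp only [apply_zetaOf_pow_eq_pow_mod hv, Nat.reduceMul, Nat.reduceMod]
  · have hv : (autResidue 60 L σ).val = 13 := by rw [hh]; rfl
    simp only [apply_zetaOf_pow_eq_pow_mod hv, Nat.reduceMul, Nat.reduceMod]
  · have hv : (autResidue 60 L σ).val = 19 := by rw [hh]; rfl
    simp only [apply_zetaOf_pow_eq_pow_mod hv, Nat.reduceMul, Nat.reduceMod]
  · have hv : (autResidue 60 L σ).val = 31 := by rw [hh]; rfl
    simp only [apply_zetaOf_pow_eq_pow_mod hv, Nat.reduceMul, Nat.reduceMod]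
  · have hv : (autResidue 60 L σ).val = 37 := by rw [hh]; rfl
    simp only [apply_zetaOf_pow_eq_pow_mod hv, Nat.reduceMul, Nat.reduceMod]
  · have hv : (autResidue 60 L σ).val = 43 := by rw [hh]; rfl
    simp only [apply_zetaOf_pow_eq_pow_mod hv, Nat.reduceMul, Nat.reduceMod]
  · have hv : (autResidue 60 L σ).val = 49 := by rw [hh]; rfl
    simp only [apply_zetaOf_pow_eq_pow_mod hv, Nat.reduceMul, Nat.reduceMod]

/-- `W({1, 7, 13, 19, 31, 37, 43, 49}) = {1, 7, 13, 19, 31, 37, 43, 49}` modulo `60` (kernel). [cite: BauerCosteItzyksonRuelle1997, §3.4] -/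
theorem stabilizerResidues_sixty :
    ((unitResidues 60).filter fun t => ∀ c ∈ unitResidues 60,
        (c * t ∈ ({1, 7, 13, 19, 31, 37, 43, 49} : Finset (ZMod 60)) ↔ c ∈ ({1, 7, 13, 19, 31, 37, 43, 49} : Finset (ZMod 60)))) = {1, 7, 13, 19, 31, 37, 43, 49} := by
  decide

/-- **`W = {1, 7, 13, 19, 31, 37, 43, 49}` ⟹ `K₁ = ℚ(√−3) = ℚ(1 + 2 * ζ ^ 20)`** for every CM type of `ℚ(ζ_60)` with this stabiliser and ANY primitive sub-pair
(`1 + 2 * ζ ^ 20` is fixed by every `σ_h`, `h ∈ W`, so lies in `K₁`; its square is `−3 < 0`; `[K₁ : ℚ] = 2`).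
[cite: KoblitzRohrlich1978, §1 p. 1184] [cite: BauerCosteItzyksonRuelle1997, §3.3] [cite: Shimura1998, §8.2 Prop. 26] -/
theorem eq_adjoin_delta_sixty (Φ : CMType L) {K₁ : IntermediateField ℚ L} (Φ₁ : CMType K₁)
    (h₁ : inducedCMType (algebraMap K₁ L) Φ₁ = Φ)
    (hp₁ : ∀ s t : K₁ →+* ℂ,
      (∀ τ : ℂ ≃+* ℂ, (τ : ℂ →+* ℂ).comp s ∈ Φ₁.1 ↔ (τ : ℂ →+* ℂ).comp t ∈ Φ₁.1) → s = t)
    (hW : ((unitResidues 60).filter fun t =>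
        ∀ c ∈ unitResidues 60, (c * t ∈ residueSet 60 Φ ↔ c ∈ residueSet 60 Φ)) = {1, 7, 13, 19, 31, 37, 43, 49}) :
    1 + 2 * zetaOf 60 L ^ 20 ∈ K₁ ∧ K₁ = IntermediateField.adjoin ℚ {1 + 2 * zetaOf 60 L ^ 20} ∧ (1 + 2 * zetaOf 60 L ^ 20) ^ 2 = -3 ∧
      Module.finrank ℚ K₁ = 2 := by
  have hcore : zetaOf 60 L ^ 20 ∈ K₁ := by
    refine (mem_iff_forall_autResidue_mem_of_primitive (N := 60) Φ Φ₁ h₁ hp₁ _).2 fun γ hγ => ?_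
    rw [hW, Finset.mem_insert] at hγ
    rcases hγ with h1 | hrest
    · rw [(autResidue_eq_one_iff (N := 60) γ).1 h1, AlgEquiv.one_apply]
    · exact apply_core_sixty hrest
  have h2 : (2 : L) ∈ K₁ := by exact_mod_cast IntermediateField.natCast_mem K₁ 2
  have hmem : 1 + 2 * zetaOf 60 L ^ 20 ∈ K₁ := add_mem (one_mem K₁) (mul_mem h2 hcore)
  have hdeg := finrank_eq_two_of_two_mul_card_eq (N := 60) Φ Φ₁ h₁ hp₁ (by rw [hW]; decide)
  exact ⟨hmem, eq_adjoin_of_mem_of_sq_eq_neg' hmem (m := 3) (by norm_num) (by rw [sq_delta_sixty]; norm_num) hdeg, sq_delta_sixty, hdeg⟩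

variable {Φ : CMType L} {A : AbelianVariety ℂ} {ι : 𝓞 L →+* End A} {θ : L →+* Module.End ℂ (complexBetti A.X 1)}

/-- **`N = 60`, `W = {1, 7, 13, 19, 31, 37, 43, 49}`: `A ∼ E^8` WITH `E` AN ELLIPTIC CURVE WITH COMPLEX MULTIPLICATION BY `𝓞_{ℚ(√−3)}`** (`K₁ = ℚ(δ)`,
`δ = 1 + 2 * ζ ^ 20`, `δ² = −3`; `𝓞_{K₁}`-equivariant isogeny onto `E^8`). [cite: KoblitzRohrlich1978, §1 p. 1184]
[cite: BauerCosteItzyksonRuelle1997, §3.3–3.4] [cite: Shimura1998, §8.2 Prop. 26, §6.2 Thm. 3] -/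
theorem exists_isIsogeny_pow_elliptic_sixty (hA : IsCMTypeRealisation Φ A ι θ)
    (hW : ((unitResidues 60).filter fun t =>
        ∀ c ∈ unitResidues 60, (c * t ∈ residueSet 60 Φ ↔ c ∈ residueSet 60 Φ)) = {1, 7, 13, 19, 31, 37, 43, 49}) :
    ∃ (K₁ : IntermediateField ℚ L) (Φ₁ : CMType K₁), IsCMField K₁ ∧ Module.finrank ℚ K₁ = 2 ∧
      1 + 2 * zetaOf 60 L ^ 20 ∈ K₁ ∧ K₁ = IntermediateField.adjoin ℚ {1 + 2 * zetaOf 60 L ^ 20} ∧ (1 + 2 * zetaOf 60 L ^ 20) ^ 2 = -3 ∧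
      inducedCMType (algebraMap K₁ L) Φ₁ = Φ ∧
      ∃ (E : AbelianVariety ℂ) (ιE : 𝓞 K₁ →+* End E) (θE : K₁ →+* Module.End ℂ (complexBetti E.X 1)),
        IsCMTypeRealisation Φ₁ E ιE θE ∧ E.IsSimple ∧ E.dim = 1 ∧
        ∃ (h : ℕ) (P : AbelianVariety ℂ) (π : Fin h → (P ⟶ E)), Nonempty (IsLimit (Fan.mk P π)) ∧ h = 8 ∧
          ∃ g : A ⟶ P, IsIsogeny g ∧
            ∀ (j : Fin h) (b : 𝓞 K₁), ι (RingOfIntegers.mapRingHom (algebraMap K₁ L : K₁ →+* L) b) ≫ (g ≫ π j) = (g ≫ π j) ≫ ιE b := by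
  haveI : IsCMField L := IsCyclotomicExtension.Rat.isCMField L (S := {60}) ⟨60, rfl, by norm_num⟩
  have h2W : 2 * ((unitResidues 60).filter fun t =>
        ∀ c ∈ unitResidues 60, (c * t ∈ residueSet 60 Φ ↔ c ∈ residueSet 60 Φ)).card = Nat.totient 60 := by
    rw [hW]; decide
  obtain ⟨K₁, Φ₁, hCM, hK2, h₁, hp₁, -, E, ιE, θE, hE, hs, hdE, h, P, π, hP, -, hhW, -, g, hg, hequiv⟩ :=
    exists_isIsogeny_power_elliptic_of_two_mul_card_filter (N := 60) hA h2W
  obtain ⟨hmem, hK, hsq, -⟩ := eq_adjoin_delta_sixty Φ Φ₁ h₁ hp₁ hW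
  have hh : h = 8 := by rw [hhW, hW]; decide
  exact ⟨K₁, Φ₁, hCM, hK2, hmem, hK, hsq, h₁, E, ιE, θE, hE, hs, hdE, h, P, π, hP, hh, g, hg, hequiv⟩

namespace CyclotomicFermatCMType

/-- `H_{1,10,49} = {1, 7, 13, 19, 31, 37, 43, 49}` modulo `60` (Koblitz's level `60`; kernel). [cite: BauerCosteItzyksonRuelle1997, §3.4] -/
theorem fermatCMType_sixty_witness : fermatCMType 60 1 10 49 = {1, 7, 13, 19, 31, 37, 43, 49} := by decide

/-- **The K–R type `Φ_{H_{1,10,49}}` modulo `60`: every realisation is `∼ E^8`, `E` elliptic with CM by `𝓞_{ℚ(√−3)}`.**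
[cite: KoblitzRohrlich1978, §1 p. 1184] [cite: BauerCosteItzyksonRuelle1997, §3.4] -/
theorem exists_isIsogeny_pow_elliptic_fermat_sixty
    {hS : ∀ c : ZMod 60, c.val.Coprime 60 → (c ∈ fermatCMType 60 1 10 49 ↔ -c ∉ fermatCMType 60 1 10 49)}
    {A : AbelianVariety ℂ} {ι : 𝓞 L →+* End A} {θ : L →+* Module.End ℂ (complexBetti A.X 1)}
    (hA : IsCMTypeRealisation (cmTypeOfResidues (L := L) (fermatCMType 60 1 10 49) hS) A ι θ) :
    ∃ (K₁ : IntermediateField ℚ L) (Φ₁ : CMType K₁), IsCMField K₁ ∧ Module.finrank ℚ K₁ = 2 ∧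
      1 + 2 * zetaOf 60 L ^ 20 ∈ K₁ ∧ K₁ = IntermediateField.adjoin ℚ {1 + 2 * zetaOf 60 L ^ 20} ∧ (1 + 2 * zetaOf 60 L ^ 20) ^ 2 = -3 ∧
      inducedCMType (algebraMap K₁ L) Φ₁ = cmTypeOfResidues (L := L) (fermatCMType 60 1 10 49) hS ∧
      ∃ (E : AbelianVariety ℂ) (ιE : 𝓞 K₁ →+* End E) (θE : K₁ →+* Module.End ℂ (complexBetti E.X 1)),
        IsCMTypeRealisation Φ₁ E ιE θE ∧ E.IsSimple ∧ E.dim = 1 ∧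
        ∃ (h : ℕ) (P : AbelianVariety ℂ) (π : Fin h → (P ⟶ E)), Nonempty (IsLimit (Fan.mk P π)) ∧ h = 8 ∧
          ∃ g : A ⟶ P, IsIsogeny g ∧
            ∀ (j : Fin h) (b : 𝓞 K₁), ι (RingOfIntegers.mapRingHom (algebraMap K₁ L : K₁ →+* L) b) ≫ (g ≫ π j) = (g ≫ π j) ≫ ιE b := by
  refine exists_isIsogeny_pow_elliptic_sixty hA ?_
  rw [residueSet_cmTypeOfResidues 60 (isCMResidueSet_fermatCMType hS), fermatCMType_sixty_witness]
  exact stabilizerResidues_sixty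

end CyclotomicFermatCMType

end Sixty

end Literature.AlgebraicGeometry.ComplexMultiplication
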